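import Summits.CriticalPhenomena.PercolationContinuityZ3.Theorems.PercNearOneGluingNoHeavyLowerTailAntitheticEarTools
import HarnessLib

/-!
# `NoHeavyLowerTail` (stmt-CriticalPhenomena-4575) — antithetic cluster pairs: the CYCLE + EAR box scheme, P INSIDE THE SPAN of the ear
# (cells of THEOREM Θ², HOME/MEMO-gen63.md §3; prim-hp-2 gen 63)

Support file (`--supports stmt-CriticalPhenomena-4575`, hull-port prover `prim-hp-2`, gen 63).  No definitions, no named facts, no sorries;
standard axioms.  Setting of …AntitheticEarTools: cycle `v 0 = s, …, v n = v 0` (`n ≥ 3`), ear `u 0 = v α, …, u ℓ = v β` (`ℓ ≥ 1`, fresh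
interior), `E = Cyc.edgeSet n v ∪ Cyc.edgeSet ℓ u`; colourings `T ⊆ Sym2 V` (`e ∈ T` = red), `X T = openCluster (T ∩ E) (v 0)`.  Here
`P = v p` lies strictly INSIDE THE SPAN of the ear: `α < p < β`.

THE BOXES (HOME/MEMO-gen63.md §3, machine-verified by lab/cycle_ear_scheme.py for all `n ≤ 9`): with `D = [0,p)` (the arc from `s` to `P`
avoiding `v β`) and `O = [p,n)`:
* TOP — the pairs of `D` red;  CELL `k` (`k < p`) — `edge v k` blue, the pairs `(k, n)` red (the blue pair of `D` nearest to `P`, `O` red);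
* FA `j k` (`α ≤ j < p`, `β ≤ k < n`) — ear red, pairs `[0,α) ∪ (j,k)` red, `edge v j`, `edge v k` blue (route `s → v α → ear → v β → P`;
  `j` = blue pair nearest to `P` on `[α,p)`, `k` = blue pair nearest to `v β` on `[β,n)`);
* FB `j k` (`p ≤ j < β`, `k < α`) — ear red, pairs `(k,j) ∪ [β,n)` red, `edge v j`, `edge v k` blue (route `s → v β → ear → v α → P`).
This file: every box lies INSIDE `{P ∈ X}` (`Cyc.mem_X_ear_of_lo/hi/routeA/routeB`) and the boxes COVER it (`Cyc.ear_span_cover`), plus the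
"nearest blue pair" selections `Cyc.near_lo` / `Cyc.near_hi`.  Uniqueness and red domination: …AntitheticEarSpanDom.
[cite: VandenbergHaggstromKahn2005, §1 p. 3 (open cluster `C_s`)]
-/

noncomputable section

namespace Summit.CriticalPhenomena.PercolationContinuityZ3.Theorems

open Literature.Probability.Percolation
open scoped Classical

namespace Antithetic

namespace Cyc

variable {V : Type*}

/-- The blue pair nearest to the LOW end of a segment `[a,b)` that is not entirely red. [this work] -/
theorem near_lo (w : ℕ → V) (T : Set (Sym2 V)) {a b : ℕ} (h : ¬ ∀ i, a ≤ i → i < b → edge w i ∈ T) :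
    ∃ k, a ≤ k ∧ k < b ∧ edge w k ∉ T ∧ ∀ i, a ≤ i → i < k → edge w i ∈ T := by
  push Not at h
  obtain ⟨i₀, hai₀, hi₀b, hi₀⟩ := h
  have hex : ∃ t, a + t < b ∧ edge w (a + t) ∉ T := ⟨i₀ - a, by omega, by rwa [show a + (i₀ - a) = i₀ by omega]⟩
  have hspec := Nat.find_spec hex
  refine ⟨a + Nat.find hex, by omega, hspec.1, hspec.2, fun i hai hik => ?_⟩
  by_contra hc
  exact Nat.find_min hex (m := i - a) (by omega) ⟨by omega, by rwa [show a + (i - a) = i by omega]⟩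

/-- The blue pair nearest to the HIGH end of a segment `[a,b)` that is not entirely red. [this work] -/
theorem near_hi (w : ℕ → V) (T : Set (Sym2 V)) {a b : ℕ} (h : ¬ ∀ i, a ≤ i → i < b → edge w i ∈ T) :
    ∃ k, a ≤ k ∧ k < b ∧ edge w k ∉ T ∧ ∀ i, k < i → i < b → edge w i ∈ T := by
  push Not at h
  obtain ⟨i₀, hai₀, hi₀b, hi₀⟩ := h
  have hex : ∃ t, t < b - a ∧ edge w (b - 1 - t) ∉ T := ⟨b - 1 - i₀, by omega, by rwa [show b - 1 - (b - 1 - i₀) = i₀ by omega]⟩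
  have hspec := Nat.find_spec hex
  refine ⟨b - 1 - Nat.find hex, by omega, by omega, hspec.2, fun i hki hib => ?_⟩
  by_contra hc
  exact Nat.find_min hex (m := b - 1 - i) (by omega) ⟨by omega, by rwa [show b - 1 - (b - 1 - i) = i by omega]⟩

variable {n : ℕ} {v : ℕ → V} {ℓ : ℕ} {u : ℕ → V} {α β p : ℕ}

/-- **Inside, arc `[0,p)` red.** [this work] -/
theorem mem_X_ear_of_lo (hpn : p < n) (T : Set (Sym2 V)) (hred : ∀ i, i < p → edge v i ∈ T) :
    v p ∈ openCluster (T ∩ (edgeSet n v ∪ edgeSet ℓ u)) (v 0) :=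
  reach_chain _ v (Nat.zero_le p) fun i _ hi => ⟨hred i hi, Or.inl ⟨i, by omega, rfl⟩⟩

/-- **Inside, arc `[p,n)` red.** [this work] -/
theorem mem_X_ear_of_hi (hper : v n = v 0) (hpn : p < n) (T : Set (Sym2 V)) (hred : ∀ i, p ≤ i → i < n → edge v i ∈ T) :
    v p ∈ openCluster (T ∩ (edgeSet n v ∪ edgeSet ℓ u)) (v 0) := by
  have h := reach_chain (T ∩ (edgeSet n v ∪ edgeSet ℓ u)) v hpn.le fun i hpi hin => ⟨hred i hpi hin, Or.inl ⟨i, hin, rfl⟩⟩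
  rw [hper] at h
  exact h.symm

/-- **Inside, route A**: `[0,α)` red, ear red, `[p,β)` red (`s → v α → ear → v β → P`). [this work] -/
theorem mem_X_ear_of_routeA (hβn : β < n) (hαp : α ≤ p) (hpβ : p ≤ β) (hu0 : u 0 = v α) (huℓ : u ℓ = v β) (T : Set (Sym2 V))
    (hpre : ∀ i, i < α → edge v i ∈ T) (hear : ∀ m, m < ℓ → edge u m ∈ T) (hpost : ∀ i, p ≤ i → i < β → edge v i ∈ T) :
    v p ∈ openCluster (T ∩ (edgeSet n v ∪ edgeSet ℓ u)) (v 0) := by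
  have h1 := reach_chain (T ∩ (edgeSet n v ∪ edgeSet ℓ u)) v (Nat.zero_le α)
    fun i _ hi => ⟨hpre i hi, Or.inl ⟨i, by omega, rfl⟩⟩
  have h2 := reach_chain (T ∩ (edgeSet n v ∪ edgeSet ℓ u)) u (Nat.zero_le ℓ)
    fun m _ hm => ⟨hear m hm, Or.inr ⟨m, hm, rfl⟩⟩
  have h3 := reach_chain (T ∩ (edgeSet n v ∪ edgeSet ℓ u)) v hpβ
    fun i hpi hiβ => ⟨hpost i hpi hiβ, Or.inl ⟨i, by omega, rfl⟩⟩
  rw [hu0, huℓ] at h2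
  exact (h1.trans h2).trans h3.symm

/-- **Inside, route B**: `[β,n)` red, ear red, `[α,p)` red (`s → v β → ear → v α → P`). [this work] -/
theorem mem_X_ear_of_routeB (hper : v n = v 0) (hβn : β < n) (hαp : α ≤ p) (hpβ : p ≤ β) (hu0 : u 0 = v α) (huℓ : u ℓ = v β)
    (T : Set (Sym2 V))
    (hpre : ∀ i, β ≤ i → i < n → edge v i ∈ T) (hear : ∀ m, m < ℓ → edge u m ∈ T) (hpost : ∀ i, α ≤ i → i < p → edge v i ∈ T) :
    v p ∈ openCluster (T ∩ (edgeSet n v ∪ edgeSet ℓ u)) (v 0) := by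
  have h1 := reach_chain (T ∩ (edgeSet n v ∪ edgeSet ℓ u)) v hβn.le
    fun i hβi hin => ⟨hpre i hβi hin, Or.inl ⟨i, hin, rfl⟩⟩
  have h2 := reach_chain (T ∩ (edgeSet n v ∪ edgeSet ℓ u)) u (Nat.zero_le ℓ)
    fun m _ hm => ⟨hear m hm, Or.inr ⟨m, hm, rfl⟩⟩
  have h3 := reach_chain (T ∩ (edgeSet n v ∪ edgeSet ℓ u)) v hαp
    fun i hαi hip => ⟨hpost i hαi hip, Or.inl ⟨i, by omega, rfl⟩⟩
  rw [hper] at h1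
  rw [hu0, huℓ] at h2
  exact (h1.symm.trans h2.symm).trans h3

/-- **Cover (P inside the span).**  If `P = v p ∈ X T` (`α < p < β`) then `T` lies in TOP, in some CELL `k`, in some FA `j k` or in some
FB `j k`. [this work] -/
theorem ear_span_cover (hn : 3 ≤ n) (hinj : ∀ i j, i < n → j < n → v i = v j → i = j) (hper : v n = v 0) (hℓ : 1 ≤ ℓ)
    (hαp : α < p) (hpβ : p < β) (hβn : β < n) (hu0 : u 0 = v α) (huℓ : u ℓ = v β)
    (hfresh : ∀ j, 0 < j → j < ℓ → ∀ i, i ≤ n → u j ≠ v i) (huinj : ∀ i j, i ≤ ℓ → j ≤ ℓ → u i = u j → i = j)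
    (T : Set (Sym2 V)) (hP : v p ∈ openCluster (T ∩ (edgeSet n v ∪ edgeSet ℓ u)) (v 0)) :
    (∀ i, i < p → edge v i ∈ T) ∨
    (∃ k, k < p ∧ edge v k ∉ T ∧ ∀ i, k < i → i < n → edge v i ∈ T) ∨
    (∃ j k, α ≤ j ∧ j < p ∧ β ≤ k ∧ k < n ∧ edge v j ∉ T ∧ edge v k ∉ T ∧
      (∀ i, i < n → (i < α ∨ (j < i ∧ i < k)) → edge v i ∈ T) ∧ ∀ m, m < ℓ → edge u m ∈ T) ∨
    (∃ j k, p ≤ j ∧ j < β ∧ k < α ∧ edge v j ∉ T ∧ edge v k ∉ T ∧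
      (∀ i, i < n → ((k < i ∧ i < j) ∨ β ≤ i) → edge v i ∈ T) ∧ ∀ m, m < ℓ → edge u m ∈ T) := by
  by_cases hD : ∀ i, i < p → edge v i ∈ T
  · exact Or.inl hD
  right
  -- `k₀`: the blue pair of `[0,p)` nearest to `P`
  obtain ⟨k₀, -, hk₀p, hk₀, hk₀red⟩ := near_hi v T (a := 0) (b := p) fun h => hD fun i hi => h i (Nat.zero_le i) hi
  by_cases hO : ∀ i, p ≤ i → i < n → edge v i ∈ T
  · exact Or.inl ⟨k₀, hk₀p, hk₀, fun i hki hin => if hip : i < p then hk₀red i hki hip else hO i (by omega) hin⟩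
  right
  -- `k₁`: the blue pair of `[p,n)` nearest to `P`
  obtain ⟨k₁, hpk₁, hk₁n, hk₁, hk₁red⟩ := near_lo v T hO
  -- the common contradiction: a closed set through `P` avoiding `s`
  have key : ∀ (I J : ℕ → Prop), I p → ¬ I 0 → ¬ I n →
      (∀ i, i < n → (I i ↔ I (i + 1)) ∨ edge v i ∉ T ∩ (edgeSet n v ∪ edgeSet ℓ u)) →
      (∀ j, 0 < j → j + 1 < ℓ → (J j ↔ J (j + 1)) ∨ edge u j ∉ T ∩ (edgeSet n v ∪ edgeSet ℓ u)) →
      (2 ≤ ℓ → (I α ↔ J 1) ∨ edge u 0 ∉ T ∩ (edgeSet n v ∪ edgeSet ℓ u)) →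
      (2 ≤ ℓ → (J (ℓ - 1) ↔ I β) ∨ edge u (ℓ - 1) ∉ T ∩ (edgeSet n v ∪ edgeSet ℓ u)) →
      (ℓ = 1 → (I α ↔ I β) ∨ edge u 0 ∉ T ∩ (edgeSet n v ∪ edgeSet ℓ u)) → False := by
    intro I J hIp hI0 hIn hcyc hearI hearA hearB hearC
    have hcl := ear_closed_of_idx hn hinj hper hℓ (by omega : α ≤ n) hβn hu0 huℓ hfresh huinj
      (T ∩ (edgeSet n v ∪ edgeSet ℓ u)) Set.inter_subset_right I J
      ⟨fun h => absurd h hI0, fun h => absurd h hIn⟩ hcyc hearI hearA hearB hearC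
    refine not_mem_cluster_of_closed (T ∩ (edgeSet n v ∪ edgeSet ℓ u)) (v 0) (v p) _ ?_ ?_ hcl hP
    · exact (mem_idxSet_v hinj hper hn hfresh I J ⟨fun h => absurd h hI0, fun h => absurd h hIn⟩ (by omega : p ≤ n)).2 hIp
    · exact fun h => hI0 ((mem_idxSet_v hinj hper hn hfresh I J ⟨fun h => absurd h hI0, fun h => absurd h hIn⟩ (Nat.zero_le n)).1 h)
  have blue_of : ∀ {i : ℕ}, edge v i ∉ T → edge v i ∉ T ∩ (edgeSet n v ∪ edgeSet ℓ u) := fun h h' => h h'.1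
  have blue_of' : ∀ {m : ℕ}, edge u m ∉ T → edge u m ∉ T ∩ (edgeSet n v ∪ edgeSet ℓ u) := fun h h' => h h'.1
  by_cases hE : ∀ m, m < ℓ → edge u m ∈ T
  · -- the ear is red
    by_cases hA : (∀ i, i < α → edge v i ∈ T) ∧ (∀ i, p ≤ i → i < β → edge v i ∈ T)
    · -- FA with `j = k₀`, `k = k₁`
      have hαk₀ : α ≤ k₀ := by
        by_contra h
        exact hk₀ (hA.1 k₀ (by omega))
      have hβk₁ : β ≤ k₁ := by
        by_contra h
        exact hk₁ (hA.2 k₁ hpk₁ (by omega))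
      refine Or.inl ⟨k₀, k₁, hαk₀, hk₀p, hβk₁, hk₁n, hk₀, hk₁, fun i hin hor => ?_, hE⟩
      rcases hor with hiα | ⟨hk₀i, hik₁⟩
      · exact hA.1 i hiα
      · by_cases hip : i < p
        · exact hk₀red i hk₀i hip
        · exact hk₁red i (by omega) hik₁
    by_cases hB : (∀ i, β ≤ i → i < n → edge v i ∈ T) ∧ (∀ i, α ≤ i → i < p → edge v i ∈ T)
    · -- FB with `j = k₁`, `k = k₀`
      have hk₁β : k₁ < β := by
        by_contra h
        exact hk₁ (hB.1 k₁ (by omega) hk₁n)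
      have hk₀α : k₀ < α := by
        by_contra h
        exact hk₀ (hB.2 k₀ (by omega) hk₀p)
      refine Or.inr ⟨k₁, k₀, hpk₁, hk₁β, hk₀α, hk₁, hk₀, fun i hin hor => ?_, hE⟩
      rcases hor with ⟨hk₀i, hik₁⟩ | hβi
      · by_cases hip : i < p
        · exact hk₀red i hk₀i hip
        · exact hk₁red i (by omega) hik₁
      · exact hB.1 i hβi hin
    -- otherwise `P ∉ X`: contradiction
    exfalso
    by_cases hk₀α : k₀ < α
    · -- the ear starts inside the red segment of `P` (`[α,p)` red); `[β,n)` is not red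
      have hpostB : ∀ i, α ≤ i → i < p → edge v i ∈ T := fun i hαi hip => hk₀red i (by omega) hip
      have hpreB : ¬ ∀ i, β ≤ i → i < n → edge v i ∈ T := fun h => hB ⟨h, hpostB⟩
      by_cases hβk₁ : β ≤ k₁
      · -- one interval `(k₀, k₁]` containing both ends of the ear
        refine key (fun i => k₀ < i ∧ i ≤ k₁) (fun _ => True) ⟨hk₀p, hpk₁⟩ (by omega) (by omega)
          (fun i hin => ?_) (fun _ _ _ => Or.inl Iff.rfl) (fun _ => Or.inl ?_) (fun _ => Or.inl ?_) (fun _ => Or.inl ?_)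
        · by_cases h1 : i = k₀
          · exact Or.inr (h1 ▸ blue_of hk₀)
          by_cases h2 : i = k₁
          · exact Or.inr (h2 ▸ blue_of hk₁)
          exact Or.inl (by constructor <;> intro h <;> omega)
        · exact ⟨fun _ => trivial, fun _ => ⟨hk₀α, by omega⟩⟩
        · exact ⟨fun _ => ⟨by omega, hβk₁⟩, fun _ => trivial⟩
        · exact ⟨fun _ => ⟨by omega, hβk₁⟩, fun _ => ⟨hk₀α, by omega⟩⟩
      · -- two intervals: `(k₀, k₁]` through `P` and `(k₃, k₄]` through `v β`
        push Not at hβk₁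
        obtain ⟨k₃, hpk₃, hk₃β, hk₃, hk₃red⟩ :=
          near_hi v T (a := p) (b := β) fun h => hk₁ (h k₁ hpk₁ hβk₁)
        obtain ⟨k₄, hβk₄, hk₄n, hk₄, hk₄red⟩ := near_lo v T hpreB
        have hk₁k₃ : k₁ ≤ k₃ := by
          by_contra h
          exact hk₁ (hk₃red k₁ (by omega) hβk₁)
        refine key (fun i => (k₀ < i ∧ i ≤ k₁) ∨ (k₃ < i ∧ i ≤ k₄)) (fun _ => True) (Or.inl ⟨hk₀p, hpk₁⟩) (by omega) (by omega)
          (fun i hin => ?_) (fun _ _ _ => Or.inl Iff.rfl) (fun _ => Or.inl ?_) (fun _ => Or.inl ?_) (fun _ => Or.inl ?_)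
        · by_cases h1 : i = k₀
          · exact Or.inr (h1 ▸ blue_of hk₀)
          by_cases h2 : i = k₁
          · exact Or.inr (h2 ▸ blue_of hk₁)
          by_cases h3 : i = k₃
          · exact Or.inr (h3 ▸ blue_of hk₃)
          by_cases h4 : i = k₄
          · exact Or.inr (h4 ▸ blue_of hk₄)
          exact Or.inl (by constructor <;> intro h <;> omega)
        · exact ⟨fun _ => trivial, fun _ => Or.inl ⟨hk₀α, by omega⟩⟩
        · exact ⟨fun _ => Or.inr ⟨hk₃β, hβk₄⟩, fun _ => trivial⟩
        · exact ⟨fun _ => Or.inr ⟨hk₃β, hβk₄⟩, fun _ => Or.inl ⟨hk₀α, by omega⟩⟩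
    · push Not at hk₀α
      by_cases hβk₁ : β ≤ k₁
      · -- the ear ends inside the red segment of `P` (`[p,β)` red); `[0,α)` is not red
        have hpostA : ∀ i, p ≤ i → i < β → edge v i ∈ T := fun i hpi hiβ => hk₁red i hpi (by omega)
        have hpreA : ¬ ∀ i, i < α → edge v i ∈ T := fun h => hA ⟨h, hpostA⟩
        obtain ⟨k₅, -, hk₅α, hk₅, hk₅red⟩ := near_hi v T (a := 0) (b := α) fun h => hpreA fun i hi => h i (Nat.zero_le i) hi
        obtain ⟨k₂, hαk₂, hk₂p, hk₂, hk₂red⟩ :=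
          near_lo v T (a := α) (b := p) fun h => hk₀ (h k₀ hk₀α hk₀p)
        have hk₂k₀ : k₂ ≤ k₀ := by
          by_contra h
          exact hk₀ (hk₂red k₀ hk₀α (by omega))
        refine key (fun i => (k₀ < i ∧ i ≤ k₁) ∨ (k₅ < i ∧ i ≤ k₂)) (fun _ => True) (Or.inl ⟨hk₀p, hpk₁⟩) (by omega) (by omega)
          (fun i hin => ?_) (fun _ _ _ => Or.inl Iff.rfl) (fun _ => Or.inl ?_) (fun _ => Or.inl ?_) (fun _ => Or.inl ?_)
        · by_cases h1 : i = k₀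
          · exact Or.inr (h1 ▸ blue_of hk₀)
          by_cases h2 : i = k₁
          · exact Or.inr (h2 ▸ blue_of hk₁)
          by_cases h3 : i = k₅
          · exact Or.inr (h3 ▸ blue_of hk₅)
          by_cases h4 : i = k₂
          · exact Or.inr (h4 ▸ blue_of hk₂)
          exact Or.inl (by constructor <;> intro h <;> omega)
        · exact ⟨fun _ => trivial, fun _ => Or.inr ⟨hk₅α, hαk₂⟩⟩
        · exact ⟨fun _ => Or.inl ⟨by omega, hβk₁⟩, fun _ => trivial⟩
        · exact ⟨fun _ => Or.inl ⟨by omega, hβk₁⟩, fun _ => Or.inr ⟨hk₅α, hαk₂⟩⟩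
      · -- the ear avoids the red segment `(k₀, k₁]` of `P`
        push Not at hβk₁
        refine key (fun i => k₀ < i ∧ i ≤ k₁) (fun _ => False) ⟨hk₀p, hpk₁⟩ (by omega) (by omega)
          (fun i hin => ?_) (fun _ _ _ => Or.inl Iff.rfl) (fun _ => Or.inl ?_) (fun _ => Or.inl ?_) (fun _ => Or.inl ?_)
        · by_cases h1 : i = k₀
          · exact Or.inr (h1 ▸ blue_of hk₀)
          by_cases h2 : i = k₁
          · exact Or.inr (h2 ▸ blue_of hk₁)
          exact Or.inl (by constructor <;> intro h <;> omega)
        · exact ⟨fun h => absurd h.1 (by omega), fun h => h.elim⟩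
        · exact ⟨fun h => h.elim, fun h => absurd h.2 (by omega)⟩
        · exact ⟨fun h => absurd h.1 (by omega), fun h => absurd h.2 (by omega)⟩
  · -- the ear has a blue pair `m`: `P` sees only its cycle segment `(k₀, k₁]` and the ear pieces hanging into it
    push Not at hE
    obtain ⟨m, hmℓ, hm⟩ := hE
    exfalso
    refine key (fun i => k₀ < i ∧ i ≤ k₁) (fun j => (j ≤ m ∧ k₀ < α) ∨ (m < j ∧ β ≤ k₁)) ⟨hk₀p, hpk₁⟩ (by omega) (by omega)
      (fun i hin => ?_) (fun j hj0 hj1 => ?_) (fun hℓ2 => ?_) (fun hℓ2 => ?_) (fun hℓ1 => ?_)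
    · by_cases h1 : i = k₀
      · exact Or.inr (h1 ▸ blue_of hk₀)
      by_cases h2 : i = k₁
      · exact Or.inr (h2 ▸ blue_of hk₁)
      exact Or.inl (by constructor <;> intro h <;> omega)
    · by_cases hjm : j = m
      · exact Or.inr (hjm ▸ blue_of' hm)
      · exact Or.inl (by constructor <;> intro h <;> omega)
    · by_cases hm0 : m = 0
      · exact Or.inr (hm0 ▸ blue_of' hm)
      · exact Or.inl (by constructor <;> intro h <;> omega)
    · by_cases hm1 : m = ℓ - 1
      · exact Or.inr (hm1 ▸ blue_of' hm)
      · exact Or.inl (by constructor <;> intro h <;> omega)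
    · have hm0 : m = 0 := by omega
      exact Or.inr (hm0 ▸ blue_of' hm)

end Cyc

end Antithetic

end Summit.CriticalPhenomena.PercolationContinuityZ3.Theorems
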